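import Summits.QuantumFields.YangMills.Theses.CertificationLength
import Summits.QuantumFields.YangMills.Theorems.OneCertifiedCubeFiniteSizeCriterion

/-!
# Route `CertificationLength`, support item `LatticeGapAtCertificationScale` (stmt-QuantumFields-16182): the uniform lattice gap is FREE at
# the certification spacing — a corollary of the PROVED `FiniteSizeCriterion` (stmt-QuantumFields-8895, `OneCertifiedCubeFiniteSizeCriterion`)

Width seat ym-line-sfw-p2-w2 g20 (cell `ym-idea-1`, free hands).  For every compact `G`, lattice representation `r`, admissible `(n, ε)`,
`ℓ₀ > 0`, certifying sizes `b_k` at the scheme's couplings with `a_k = ℓ₀/b_k` and `2·L_k + 1 ≥ (8n+7)·b_k`: `HasLatticeMassGap r sch (κ/ℓ₀)` with the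
universal rate `κ(n, ε)` of `FiniteSizeCriterion` — its constant `C(A, B)` is independent of `β, b, S, t`, and
`e^{−κ t / b_k} = e^{−(κ/ℓ₀)·a_k·t}`.  Pure instantiation; no summit, no continuum statement and no mass gap in physical units is proved
(the lattice gap at the certification spacing says nothing about `CertificationLengthDiverges`, the route's open crux).
-/

set_option autoImplicit false

namespace Summit.QuantumFields.YangMills.Theorems.CertificationLengthGap

open MeasureTheory Filter
open Literature.MathematicalPhysics.QuantumLattice Literature.MathematicalPhysics.AQFT Literature.MathematicalPhysics.QuantumFieldTheory

/-- ★★ **`LatticeGapAtCertificationScale` HOLDS** (support item stmt-QuantumFields-16182 of route `CertificationLength`): instantiate the proved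
`FiniteSizeCriterion` at `(β, b) = (sch.β k, b_k)` for every `k`, with `Δ := κ/ℓ₀` (`Δ·a_k·t = κ·t/b_k` as `a_k = ℓ₀/b_k`); tori of side
`2S+1 ≥ 2L_k+1 ≥ (8n+7)b_k`. [cite: DobrushinShlosman1985, Thm 1; Martinelli1999, Thm 2.1] -/
theorem latticeGapAtCertificationScale_proof :
    Summit.QuantumFields.YangMills.Theses.CertificationLength.LatticeGapAtCertificationScale := by
  unfold Summit.QuantumFields.YangMills.Theses.CertificationLength.LatticeGapAtCertificationScale
  intro G _ _ _ _ r n ε hn hε hq ℓ₀ hℓ₀ bseq sch hk ha hL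
  letI : MeasurableSpace G := borel G
  haveI : BorelSpace G := ⟨rfl⟩
  obtain ⟨κ, hκ, hFSC⟩ := FiniteSizeCriterion_proof n ε hn hε hq
  refine ⟨κ / ℓ₀, div_pos hκ hℓ₀, ?_⟩
  intro A B
  obtain ⟨C, hC⟩ := hFSC G r.N r.ρ r.continuous r.injective A B
  refine ⟨C, Filter.Eventually.of_forall fun k => ?_⟩
  intro S hS m hm
  have hS' : (8 * n + 7) * bseq k ≤ 2 * S + 1 := (hL k).trans (by omega)
  have h := hC (sch.β k) (bseq k) (hk k).1 (hk k).2 S hS' m hm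
  have hb : (0 : ℝ) < (bseq k : ℝ) := by exact_mod_cast (hk k).1
  have heq : κ / ℓ₀ * (sch.a k * (m : ℝ)) = κ * (m : ℝ) / (bseq k : ℝ) := by
    rw [ha k]; field_simp
  rw [heq]
  exact h

end Summit.QuantumFields.YangMills.Theorems.CertificationLengthGap
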